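import Summits.BirchSwinnertonDyer.BirchSwinnertonDyer.Theorems.UniversalToricDescentLambdaTransport
import Summits.BirchSwinnertonDyer.BirchSwinnertonDyer.Theorems.UniversalToricDescentLambdaNormProfile
import Summits.BirchSwinnertonDyer.Rank1Residual.X11b.AnticyclotomicControlMap
import Summits.BirchSwinnertonDyer.Rank1Residual.X11b.QuadraticTorsionOfIrr
import Literature.NumberTheory.EllipticCurves.IwasawaTowerTorsionProofs
import Literature.NumberTheory.EllipticCurves.NonEisensteinPrimeOfSurjective
import Literature.NumberTheory.EllipticCurves.HeegnerPoints
import HarnessLib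

/-!
# Route UniversalToricDescent — the BASE-LAYER DEGREE CERTIFICATE: `#Sel_𝔭^Σ(K, E[p^∞])[p] ≤ p^{λ}`
# (support S-cert₀ of the crux idea `degree-only-twin-clause`, utd-idea g25, on ♭B′
# stmt-BirchSwinnertonDyer-27401 `TwinWanFrameAtThreeMultTresT` / ♭C₀_T 27173)

Width seat bsd-wall-utd-p2-w2 g5 (`--supports stmt-BirchSwinnertonDyer-27401`). THEOREMS ONLY (no definition,
no named fact, no `sorry`); BSD is not advanced by this file.

The deciding chain of the route reads the twin's rational Wan clause `∃ k, 3^k·Ch(X′)·R₀⟦T⟧ ⊆ (𝓛′)` only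
through the Weierstrass-DEGREE inequality `λ(𝓛′) ≤ λ(Ch X′)` (utd-idea g25, `Cruxes/…/Sketch-utd-idea-g25`
§4). This file proves the first lemma of the CERTIFICATE road for that inequality: a class-by-class FLOOR
for `λ(X′)` read at the base layer `K`. For Castella's anticyclotomic Selmer structure (strict at `𝔭`,
relaxed at the other primes above `p`, trivial off `p` outside `Σ`; tree objects `AcSelmer.selmerAcBase`
over `K`, `AcSelmer.selmerAc` over `K_∞`, `AcSelmer.XAc = Hom(Sel_𝔭^Σ(K_∞, E[p^∞]), ℚ/ℤ)`):

* §1 `natCard_torsionBy_selmerAcBase_le_of_injective`: if the control map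
  `s : Sel_𝔭^Σ(K, E[p^∞]) → Sel_𝔭^Σ(K_∞, E[p^∞])^Γ` (`AcSelmer.controlMap`) is injective and
  `Sel_𝔭^Σ(K_∞, E[p^∞])[p]` is finite, then `#Sel_𝔭^Σ(K, E[p^∞])[p] ≤ #Sel_𝔭^Σ(K_∞, E[p^∞])[p]`;
  `controlMap_baseChange_injective_of_irr`: `s` IS injective for `E/ℚ` with `E[p]` irreducible base-changed
  to ANY quadratic `K`, for EVERY `ℤ_p`-extension (`E(K_∞)[p^∞] = 0`: `X11b.Transvection.torsion_eq_zero_of_irr`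
  + the pro-`p` fixed-point principle; no (ram) hypothesis, no `p ≠ 2`).
* §2 `natCard_torsionBy_selmerAcBase_le_pow_lambdaInvariant`: for finite `Σ`, `X = X_ac^Σ(E_K)` `Λ`-torsion
  with `μ(X) = 0` and NO non-zero finite `Λ`-submodule: `#Sel_𝔭^Σ(K, E[p^∞])[p] ≤ p^{λ(X)}` — the top layer
  has exactly `p^{λ(X)}` classes killed by `p` (`UniversalToricDescentLambdaTransport.pow_lambdaInvariant_eq_…`,
  Greenberg–Vatsal: `X` is `ℤ_p`-free of rank `λ`), and the base layer injects.
* §3 `natCard_torsionBy_selmerAcBase_le_pow_of_generator_normProfile`: the same bound with `λ(X)` replaced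
  by the ROUTE'S CURRENCY — the norm-profile index `n` of any generator `g` of `Ch_Λ(X)·R₀⟦T⟧`
  (`‖g_i‖ < 1 (i < n)`, `‖g_n‖ = 1`; then `μ(X) = 0` and `λ(X) = n`, tree `UniversalToricDescentLambdaNormProfile`).
* §4 `baseLayerDegreeCertificate`: the instance typed by utd-idea g25 (`BaseLayerDegreeCertificate`, with
  its binders VERBATIM: `p = 3`, `Σ = ∅`, `ρ̄₃` onto, `K` imaginary quadratic, the strict place `𝔭′`),
  and the certificate's contrapositive reading `degree_le_of_pow_le_natCard`: an explicit `3`-descent over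
  `K` exhibiting `3^m ≤ #Sel_{𝔭′}(K, W′[3^∞])[3]` certifies `m ≤ n`.

HONEST STATUS. Pure control/duality algebra on the tree's CONSTRUCTED objects; the hypotheses «`Λ`-torsion»
and «no non-zero finite `Λ`-submodule» are NOT discharged here (for the `Σ₀`-imprimitive group the latter is
Lei–Müller–Xia 2024 Lemma 3.4 BY NAME, `LeiMullerXia2023.lemma34_XAc_noFiniteSubmodule`, p636275; the
primitive `Σ = ∅` statement is not printed — utd-ty1 g8 flag «imprimitive»); every theorem below is stated
for an ARBITRARY finite `Σ` so that both readings are served. Nothing here proves ♭B′, ♭C₀_T or any class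
of BSD. References: [GreenbergLNM1716] §3 Lemma 3.1, §1 p. 60; [GreenbergVatsal2000] §2 Prop. (2.8);
[Washington1997] §13.2; [JetchevSkinnerWan2017] §3.3; HOME pub/bsd-wall/bsd-wall-utd-idea/Ideas/idea-degree-only-twin-clause.md.
-/

set_option autoImplicit false
-- `…BirchSwinnertonDyer.BirchSwinnertonDyer.Theorems…` is the problem's mandated namespace (D-0017).
set_option linter.dupNamespace false

noncomputable section

open scoped Classical AddSubgroup

namespace Summit.BirchSwinnertonDyer.BirchSwinnertonDyer.Theorems.UniversalToricDescentBaseLayerDegreeCertificate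

open NumberField IsDedekindDomain Field
open Literature.NumberTheory.EllipticCurves Literature.NumberTheory.EllipticCurves.IwasawaAlgebra
  Literature.NumberTheory.EllipticCurves.GreenbergSelmer Literature.NumberTheory.EllipticCurves.Rank1Residual
  Literature.NumberTheory.GaloisRepresentations WeierstrassCurve
  Summit.BirchSwinnertonDyer.Rank1Residual.X11b Summit.BirchSwinnertonDyer.Rank1Residual.X11b.AcSelmer
  Summit.BirchSwinnertonDyer.BirchSwinnertonDyer.Theorems.UniversalToricDescentAcDualMuZero
  Summit.BirchSwinnertonDyer.BirchSwinnertonDyer.Theorems.UniversalToricDescentLambdaTransport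
  Summit.BirchSwinnertonDyer.BirchSwinnertonDyer.Theorems.UniversalToricDescentLambdaNormProfile

/-! ### §1 The base layer injects into the top layer on `p`-torsion -/

section Generic

variable {K : Type} [Field K] [NumberField K]
  (W : WeierstrassCurve K) [W.IsElliptic] (p : ℕ) [Fact p.Prime] (κ : ZpExtension K p)
  (𝔭 : HeightOneSpectrum (𝓞 K)) (S : Set (HeightOneSpectrum (𝓞 K)))
  (γ : absoluteGaloisGroup K) [Fact (κ.IsTopGenerator γ)]

omit [W.IsElliptic] [Fact (κ.IsTopGenerator γ)] in
/-- **`#Sel_𝔭^Σ(K, E[p^∞])[p] ≤ #Sel_𝔭^Σ(K_∞, E[p^∞])[p]` when the control map is injective** and the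
right-hand side is finite: the control map `s = res_{K → K_∞}` (`AcSelmer.controlMap`) is additive, so it
carries `p`-torsion classes over `K` to `p`-torsion classes over `K_∞`, injectively.
[cite: GreenbergLNM1716, §3 Lemma 3.1 (p. 86)] [cite: JetchevSkinnerWan2017, §3.3 (control; shape only)] -/
theorem natCard_torsionBy_selmerAcBase_le_of_injective
    (hinj : Function.Injective (controlMap W p κ 𝔭 S γ))
    [Finite {s : selmerAc W p κ 𝔭 S // p • s = 0}] :
    Nat.card ((selmerAcBase W p 𝔭 S)[(p : ℤ)]) ≤ Nat.card {s : selmerAc W p κ 𝔭 S // p • s = 0} := by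
  -- the restriction of `s` to `p`-torsion, read in `Sel_𝔭^Σ(K_∞, E[p^∞])`
  let f : (selmerAcBase W p 𝔭 S)[(p : ℤ)] → {s : selmerAc W p κ 𝔭 S // p • s = 0} := fun c ↦
    ⟨((controlMap W p κ 𝔭 S γ (c : selmerAcBase W p 𝔭 S) :
        IwasawaDual.endInvariants (conjSelmerAc W p κ 𝔭 S γ - 1)) : selmerAc W p κ 𝔭 S), by
      have hc : p • (c : selmerAcBase W p 𝔭 S) = 0 := AddSubgroup.torsionBy.nsmul_iff.mp c.2
      rw [← AddSubgroupClass.coe_nsmul, ← map_nsmul, hc, map_zero]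
      rfl⟩
  refine Nat.card_le_card_of_injective f fun a b hab ↦ ?_
  have h1 : ((controlMap W p κ 𝔭 S γ (a : selmerAcBase W p 𝔭 S) :
        IwasawaDual.endInvariants (conjSelmerAc W p κ 𝔭 S γ - 1)) : selmerAc W p κ 𝔭 S) =
      ((controlMap W p κ 𝔭 S γ (b : selmerAcBase W p 𝔭 S) :
        IwasawaDual.endInvariants (conjSelmerAc W p κ 𝔭 S γ - 1)) : selmerAc W p κ 𝔭 S) := by
    have h0 := congrArg Subtype.val hab
    exact h0
  have h : controlMap W p κ 𝔭 S γ (a : selmerAcBase W p 𝔭 S) =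
      controlMap W p κ 𝔭 S γ (b : selmerAcBase W p 𝔭 S) := Subtype.ext h1
  exact Subtype.ext (hinj h)

/-- **… and `#Sel_𝔭^Σ(K, E[p^∞])[p] ≤ p^{λ(X_ac^Σ)}`** for finite `Σ` when `X = X_ac^Σ(E[p^∞])` is
`Λ`-torsion with `μ(X) = 0` and without non-zero finite `Λ`-submodule and the control map is injective:
the top layer has exactly `p^{λ(X)}` classes killed by `p`
(`UniversalToricDescentLambdaTransport.pow_lambdaInvariant_eq_natCard_selmerAc_pTorsion`: `X` is then
`ℤ_p`-free of rank `λ(X)` and `X/pX` is the character group of `Sel[p]`).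
[cite: GreenbergVatsal2000, §2 Prop. (2.8) (proof, p. 27)] [cite: Washington1997, §13.2] -/
theorem natCard_torsionBy_selmerAcBase_le_pow_lambdaInvariant_of_injective (hS : S.Finite)
    (hinj : Function.Injective (controlMap W p κ 𝔭 S γ))
    (hT : Module.IsTorsion (IwasawaAlgebra p) (XAc W p κ 𝔭 S γ))
    (hμ : muInvariant p (XAc W p κ 𝔭 S γ) = 0)
    (hnf : ∀ N : Submodule (IwasawaAlgebra p) (XAc W p κ 𝔭 S γ), Finite N → N = ⊥) :
    Nat.card ((selmerAcBase W p 𝔭 S)[(p : ℤ)]) ≤ p ^ lambdaInvariant p (XAc W p κ 𝔭 S γ) := by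
  haveI := finite_selmerAc_pTorsion_of_noFiniteSubmodule W p κ 𝔭 S γ hS hT hμ hnf
  rw [pow_lambdaInvariant_eq_natCard_selmerAc_pTorsion W p κ 𝔭 S γ hS hT hμ hnf]
  exact natCard_torsionBy_selmerAcBase_le_of_injective W p κ 𝔭 S γ hinj

end Generic

/-! ### §2 `E/ℚ` with `E[p]` irreducible, base-changed to a quadratic field: the control map injects -/

section Quadratic

variable (W : WeierstrassCurve ℚ) [W.IsElliptic] (p : ℕ) [Fact p.Prime]
  (K : Type) [Field K] [NumberField K] (κ : ZpExtension K p)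
  (𝔭 : HeightOneSpectrum (𝓞 K)) (S : Set (HeightOneSpectrum (𝓞 K)))
  (γ : absoluteGaloisGroup K) [hγ : Fact (κ.IsTopGenerator γ)]

/-- **`E(K_∞)[p^∞] = 0`** for `E/ℚ` with `E[p]` irreducible, `K` quadratic and ANY `ℤ_p`-extension `κ`
of `K`: `E(K)[p] = 0` (`X11b.Transvection.torsion_eq_zero_of_irr`: a `Γ_K`-fixed vector would span a
`Γ_ℚ`-stable line) and a pro-`p` group acting on a non-zero finite `p`-group has a non-zero fixed point
(`WeierstrassCurve.fixedPoints_kerSubgroup_geomPrimaryTorsion_eq_bot`). No (ram) prime, no `p ≠ 2`.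
[cite: GreenbergLNM1716, §1 p. 62 and §4 p. 109 (the fixed-point principle)] [cite: Castella2018Erratum, Lemma 2.1 (hypothesis (glob))] -/
theorem fixedPoints_kerSubgroup_baseChange_eq_bot_of_irr (hirr : Irr W p)
    (hK : Module.finrank ℚ K = 2) :
    FixedPoints.addSubgroup κ.kerSubgroup ((W.baseChange K).geomPrimaryTorsion p) = ⊥ :=
  (W.baseChange K).fixedPoints_kerSubgroup_geomPrimaryTorsion_eq_bot κ fun P hP ↦
    Transvection.torsion_eq_zero_of_irr W p hirr K hK P (by rw [← natCast_zsmul] at hP; exact hP)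

/-- **The control map `Sel_𝔭^Σ(K, E[p^∞]) → Sel_𝔭^Σ(K_∞, E[p^∞])^Γ` is injective** for `E/ℚ` with `E[p]`
irreducible base-changed to a quadratic `K`, for every `ℤ_p`-extension `κ`, every `𝔭`, `Σ`, `γ`
(Greenberg's Lemma 3.1 with `B = E(K_∞)[p^∞] = 0`, tree `controlMap_injective_of_fixedPoints_eq_bot`).
The (ram)-free form of `X11b.AcSelmer.controlMap_injective_of_irr_of_ram`.
[cite: GreenbergLNM1716, §3 Lemma 3.1 (p. 86)] [cite: JetchevSkinnerWan2017, §3.3 (control; shape only)] -/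
theorem controlMap_baseChange_injective_of_irr (hirr : Irr W p) (hK : Module.finrank ℚ K = 2) :
    Function.Injective (controlMap (W.baseChange K) p κ 𝔭 S γ) :=
  controlMap_injective_of_fixedPoints_eq_bot hγ.out
    (fixedPoints_kerSubgroup_baseChange_eq_bot_of_irr W p K κ hirr hK) γ

/-- **§2 main: `#Sel_𝔭^Σ(K, E[p^∞])[p] ≤ p^{λ(X_ac^Σ(E_K))}`** for `E/ℚ` with `E[p]` irreducible, `K`
quadratic, ANY `ℤ_p`-extension `κ` with topological generator `γ`, any `𝔭` and finite `Σ`, whenever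
`X_ac^Σ(E_K)` is `Λ`-torsion with `μ = 0` and has no non-zero finite `Λ`-submodule.
[cite: GreenbergVatsal2000, §2 Prop. (2.8) (proof, p. 27)] [cite: GreenbergLNM1716, §3 Lemma 3.1 (p. 86)] -/
theorem natCard_torsionBy_selmerAcBase_le_pow_lambdaInvariant (hirr : Irr W p)
    (hK : Module.finrank ℚ K = 2) (hS : S.Finite)
    (hT : Module.IsTorsion (IwasawaAlgebra p) (XAc (W.baseChange K) p κ 𝔭 S γ))
    (hμ : muInvariant p (XAc (W.baseChange K) p κ 𝔭 S γ) = 0)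
    (hnf : ∀ N : Submodule (IwasawaAlgebra p) (XAc (W.baseChange K) p κ 𝔭 S γ), Finite N → N = ⊥) :
    Nat.card ((selmerAcBase (W.baseChange K) p 𝔭 S)[(p : ℤ)]) ≤
      p ^ lambdaInvariant p (XAc (W.baseChange K) p κ 𝔭 S γ) :=
  natCard_torsionBy_selmerAcBase_le_pow_lambdaInvariant_of_injective (W.baseChange K) p κ 𝔭 S γ hS
    (controlMap_baseChange_injective_of_irr W p K κ 𝔭 S γ hirr hK) hT hμ hnf

/-! ### §3 The bound in the route's currency: the norm profile of a generator of `Ch_Λ(X)·R₀⟦T⟧` -/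

/-- **`#Sel_𝔭^Σ(K, E[p^∞])[p] ≤ p^n` for the norm-profile index `n` of ANY generator `g` of
`Ch_Λ(X_ac^Σ(E_K))·R₀⟦T⟧`** (`‖g_i‖ < 1` for `i < n`, `‖g_n‖ = 1`), `X_ac^Σ(E_K)` torsion without non-zero
finite `Λ`-submodule (`E[p]` irreducible, `K` quadratic, finite `Σ`): a unit coefficient gives `μ = 0`
(`UniversalToricDescentAcDualMuZero.muInvariant_eq_zero_of_map_charIdeal_eq_span`) and then `λ = n`
(`UniversalToricDescentLambdaNormProfile.lambdaInvariant_eq_of_generator_normProfile`). This is the shape in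
which the route's defect transport (`DefectTransportModThreePT`) hands over `Ch(X′)` — so the certificate
needs no λ-invariant bookkeeping of its own. [cite: Washington1997, §13.2 and §7.1] [cite: GreenbergVatsal2000, p. 2, (1)–(2)] -/
theorem natCard_torsionBy_selmerAcBase_le_pow_of_generator_normProfile (hirr : Irr W p)
    (hK : Module.finrank ℚ K = 2) (hS : S.Finite)
    (hT : Module.IsTorsion (IwasawaAlgebra p) (XAc (W.baseChange K) p κ 𝔭 S γ))
    (hnf : ∀ N : Submodule (IwasawaAlgebra p) (XAc (W.baseChange K) p κ 𝔭 S γ), Finite N → N = ⊥)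
    {g : UnrSeries p} {n : ℕ}
    (hg : (XAc.charIdeal (W.baseChange K) p κ 𝔭 S γ).map (PowerSeries.map (Halves.toUnr p)) =
      Ideal.span {g})
    (hgn : (∀ i < n, ‖((PowerSeries.coeff i g : unrIntegers p) : ℂ_[p])‖ < 1) ∧
      ‖((PowerSeries.coeff n g : unrIntegers p) : ℂ_[p])‖ = 1) :
    Nat.card ((selmerAcBase (W.baseChange K) p 𝔭 S)[(p : ℤ)]) ≤ p ^ n := by
  haveI := XAc.module_finite κ 𝔭 S γ hS (W := W.baseChange K)
  have hμ : muInvariant p (XAc (W.baseChange K) p κ 𝔭 S γ) = 0 :=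
    muInvariant_eq_zero_of_map_charIdeal_eq_span (XAc (W.baseChange K) p κ 𝔭 S γ) hT hg ⟨n, hgn.2⟩
  have hlam : lambdaInvariant p (XAc (W.baseChange K) p κ 𝔭 S γ) = n :=
    lambdaInvariant_eq_of_generator_normProfile (W.baseChange K) p κ 𝔭 S γ hS hT hμ hg hgn
  rw [← hlam]
  exact natCard_torsionBy_selmerAcBase_le_pow_lambdaInvariant W p K κ 𝔭 S γ hirr hK hS hT hμ hnf

/-- **The certificate, contrapositive reading**: an observed `p^m ≤ #Sel_𝔭^Σ(K, E[p^∞])[p]` (e.g. `m`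
independent classes exhibited by an explicit `p`-descent over `K` with Castella's local conditions)
certifies `m ≤ n` for the profile index `n` of `Ch_Λ(X_ac^Σ)·R₀⟦T⟧`. [cite: GreenbergVatsal2000, §2 Prop. (2.8)] -/
theorem degree_le_of_pow_le_natCard_torsionBy_selmerAcBase (hirr : Irr W p)
    (hK : Module.finrank ℚ K = 2) (hS : S.Finite)
    (hT : Module.IsTorsion (IwasawaAlgebra p) (XAc (W.baseChange K) p κ 𝔭 S γ))
    (hnf : ∀ N : Submodule (IwasawaAlgebra p) (XAc (W.baseChange K) p κ 𝔭 S γ), Finite N → N = ⊥)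
    {g : UnrSeries p} {n : ℕ}
    (hg : (XAc.charIdeal (W.baseChange K) p κ 𝔭 S γ).map (PowerSeries.map (Halves.toUnr p)) =
      Ideal.span {g})
    (hgn : (∀ i < n, ‖((PowerSeries.coeff i g : unrIntegers p) : ℂ_[p])‖ < 1) ∧
      ‖((PowerSeries.coeff n g : unrIntegers p) : ℂ_[p])‖ = 1)
    {m : ℕ} (hobs : p ^ m ≤ Nat.card ((selmerAcBase (W.baseChange K) p 𝔭 S)[(p : ℤ)])) :
    m ≤ n :=
  (Nat.pow_le_pow_iff_right (Fact.out : p.Prime).one_lt).mp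
    (hobs.trans (natCard_torsionBy_selmerAcBase_le_pow_of_generator_normProfile W p K κ 𝔭 S γ hirr hK
      hS hT hnf hg hgn))

end Quadratic

/-! ### §4 The instance typed by utd-idea g25 (`BaseLayerDegreeCertificate`, binders verbatim) -/

/-- **`BaseLayerDegreeCertificate` (utd-idea g25, `Cruxes/TwinWanFrameAtThree…/Sketch` §5), PROVED** — for the
twin's `X′ = X_ac(W′_K; slot 𝔭′, Σ = ∅)` at `p = 3`: `ρ̄_{W′,3}` onto, `K` imaginary quadratic, `κ` an
anticyclotomic `ℤ₃`-extension with topological generator `γ`, `𝔭′ ∋ 3`; if `X′` is `Λ`-torsion without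
non-zero finite `Λ`-submodule and `Ch(X′)·R₀⟦T⟧ = (g)` with `FirstUnitIndex g n` (`‖g_i‖ < 1 (i < n)`,
`‖g_n‖ = 1`), then `#Sel_{𝔭′}(K, W′[3^∞])[3] ≤ 3^n`. (The binders «anticyclotomic» and «`𝔭′ ∋ 3`» are the
crux's and are idle here: the bound holds for every `ℤ₃`-extension and every place.) Surjectivity gives
irreducibility (`hasIrreducibleModPGaloisRep_of_hasSurjectiveModNGaloisRep`).
[cite: GreenbergVatsal2000, §2 Prop. (2.8) (proof, p. 27)] [cite: GreenbergLNM1716, §3 Lemma 3.1 (p. 86)] -/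
theorem baseLayerDegreeCertificate :
    ∀ (W' : WeierstrassCurve ℚ) [W'.IsElliptic] [W'.IsGloballyMinimal] (K : Type) [Field K] [NumberField K],
      W'.HasSurjectiveModNGaloisRep 3 → IsImaginaryQuadratic K →
      ∀ (κ : ZpExtension K 3), κ.IsAnticyclotomic →
      ∀ (γ : Field.absoluteGaloisGroup K) [Fact (κ.IsTopGenerator γ)]
        (𝔭' : HeightOneSpectrum (𝓞 K)), ((3 : ℕ) : 𝓞 K) ∈ 𝔭'.asIdeal →
      Module.IsTorsion (IwasawaAlgebra 3) (XAc (W'.baseChange K) 3 κ 𝔭' ∅ γ) →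
      (∀ N : Submodule (IwasawaAlgebra 3) (XAc (W'.baseChange K) 3 κ 𝔭' ∅ γ), Finite N → N = ⊥) →
      ∀ (g : UnrSeries 3) (n : ℕ),
        (XAc.charIdeal (W'.baseChange K) 3 κ 𝔭' ∅ γ).map (PowerSeries.map (Halves.toUnr 3)) =
          Ideal.span {g} →
        ((∀ i < n, ‖((PowerSeries.coeff i g : unrIntegers 3) : ℂ_[3])‖ < 1) ∧
          ‖((PowerSeries.coeff n g : unrIntegers 3) : ℂ_[3])‖ = 1) →
        Nat.card ((selmerAcBase (W'.baseChange K) 3 𝔭' ∅)[((3 : ℕ) : ℤ)]) ≤ 3 ^ n := by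
  intro W' _ _ K _ _ hsurj hK κ _ γ _ 𝔭' _ hT hnf g n hg hgn
  haveI : Fact (Nat.Prime 3) := ⟨Nat.prime_three⟩
  have hirr : Irr W' 3 := hasIrreducibleModPGaloisRep_of_hasSurjectiveModNGaloisRep W' 3 hsurj
  exact natCard_torsionBy_selmerAcBase_le_pow_of_generator_normProfile W' 3 K κ 𝔭' ∅ γ hirr hK.1
    Set.finite_empty hT hnf hg hgn

/-- **The certificate at `p = 3` in use**: under the binders of `baseLayerDegreeCertificate`, an explicit
`3`-descent over `K` exhibiting `3^m ≤ #Sel_{𝔭′}(K, W′[3^∞])[3]` certifies `m ≤ n` — tier `m` of the degree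
clause `λ(𝓛′) ≤ λ(Ch X′)` for that class (utd-idea g25 card, «Cheapest falsifier (2)»).
[cite: GreenbergVatsal2000, §2 Prop. (2.8)] -/
theorem degree_le_of_pow_le_natCard
    (W' : WeierstrassCurve ℚ) [W'.IsElliptic] [W'.IsGloballyMinimal] (K : Type) [Field K] [NumberField K]
    (hsurj : W'.HasSurjectiveModNGaloisRep 3) (hK : IsImaginaryQuadratic K) (κ : ZpExtension K 3)
    (γ : Field.absoluteGaloisGroup K) [Fact (κ.IsTopGenerator γ)] (𝔭' : HeightOneSpectrum (𝓞 K))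
    (hT : Module.IsTorsion (IwasawaAlgebra 3) (XAc (W'.baseChange K) 3 κ 𝔭' ∅ γ))
    (hnf : ∀ N : Submodule (IwasawaAlgebra 3) (XAc (W'.baseChange K) 3 κ 𝔭' ∅ γ), Finite N → N = ⊥)
    {g : UnrSeries 3} {n : ℕ}
    (hg : (XAc.charIdeal (W'.baseChange K) 3 κ 𝔭' ∅ γ).map (PowerSeries.map (Halves.toUnr 3)) =
      Ideal.span {g})
    (hgn : (∀ i < n, ‖((PowerSeries.coeff i g : unrIntegers 3) : ℂ_[3])‖ < 1) ∧
      ‖((PowerSeries.coeff n g : unrIntegers 3) : ℂ_[3])‖ = 1)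
    {m : ℕ} (hobs : 3 ^ m ≤ Nat.card ((selmerAcBase (W'.baseChange K) 3 𝔭' ∅)[((3 : ℕ) : ℤ)])) :
    m ≤ n := by
  haveI : Fact (Nat.Prime 3) := ⟨Nat.prime_three⟩
  have hirr : Irr W' 3 := hasIrreducibleModPGaloisRep_of_hasSurjectiveModNGaloisRep W' 3 hsurj
  exact degree_le_of_pow_le_natCard_torsionBy_selmerAcBase W' 3 K κ 𝔭' ∅ γ hirr hK.1 Set.finite_empty hT hnf
    hg hgn hobs

end Summit.BirchSwinnertonDyer.BirchSwinnertonDyer.Theorems.UniversalToricDescentBaseLayerDegreeCertificate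

end
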